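import Summits.KontsevichZagierPeriods.Zeta5Search.WedgeDictionaryFaceAbel
import Summits.KontsevichZagierPeriods.Zeta5Search.WedgeDictionaryFaceSymmetric
import Summits.KontsevichZagierPeriods.Zeta5Search.WedgeDictionaryFaceBookkeeping
import Summits.KontsevichZagierPeriods.Zeta5Search.WedgeDictionaryVanishing
import HarnessLib

/-!
# CF-M3 on the face `b₇ = 0` of the wedge dictionary, uniformly in `(N; b₁, …, b₆)` (cell `pub-zeta5`)

HONEST FRAMING: systematic search; no irrationality claim unless certified.

OUR work (Summit side; lead/literature seat generation 4 wearing the lead hat, 2026-08-20). Main file of the face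
series (`WedgeDictionaryFaceRelation` → `WedgeDictionaryFaceAbel` → this; tools `WedgeDictionaryFaceSymmetric`,
`WedgeDictionaryFaceBookkeeping`). The conjecture `casoratianClosedForm`
(CF-M3, gen-1 g4, `WedgeDictionaryClosedForms`; INTERNALLY MINTED) gives the Casoratian
`M₃(b) = U(b)W(b+e_j) − U(b+e_j)W(b)` (`quadM3`) of the canonical `ζ(5)`/`ζ(3)` coefficients of the
Brown–Zudilin dual family in closed form. Before this file it was a theorem on the corner `(N;0⁷)`
(`cornerIdentity`), the edge `(N;1,0⁶)` and the fan `(N;k,0⁶)`, `k ≤ 3`, and exact-checked per shape for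
`Σ b_j ≤ 18`.

**`casoratianClosedForm_face`**: CF-M3 holds for EVERY `b` in the conjecture's box with `b₇ = 0`:
`M₃(b)·N!·∏_{j<k}(N−b_j−b_k)! = (−1)^N·4·d!·∏_j(N−b_j)!·Ω(b)` (`Ω(b) = 1` there, `omegaVWP_eq_one`).
Proof: induction on `Σ_{j≤6} b_j` from the corner (`quadM3_bCorner`) by Abel's lemma `quadM3_face_step`
(`d(a)·M₃(b) = γ₀·M₃(a)`, `a = b − e_j`), with the factorial bookkeeping
`∏_{j<k}(N−a_j−a_k)! = ∏_{j<k}(N−b_j−b_k)!·γ₀·(N−b_j+1)`, `∏_k(N−a_k)! = ∏_k(N−b_k)!·(N−b_j+1)`,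
`d(a)! = (d(b)+1)·d(b)!`; `γ₀ ≠ 0` by the pair-sum hypothesis (base case placed on `bCorner N` by
`quadM3_congr` of `WedgeDictionaryFaceSymmetric`; `allPairs_bounds` reused from `WedgeDictionaryVanishing`).
Corollaries: `casoratianClosedForm_of_slot_zero` — CF-M3 on EVERY face `{b_j = 0}`, `j ∈ [1,7]` (slot symmetry
`quadM3_swap`); `quadM3_fan` — gen-1 g4's fan formula `M₃(n;k,0⁶) = (−1)ⁿ4(3n−k)!(n!/(n−k)!)⁵/n!¹⁵` for ALL `k ≤ n`
(previously `k ≤ 3`, one certificate each). The INTERIOR `min_j b_j ≥ 1` is not treated here (paper-level proof by the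
cell's gen-1 g5, `HOME/pub-zeta5-gen-1/PROOF-NOTES-g5.md` §4, Lean pending).
-/

noncomputable section

open Finset Polynomial

namespace Summit.KontsevichZagierPeriods.Zeta5Search.WedgeDictionary

open Summit.KontsevichZagierPeriods.Zeta5Search.DualSeries
open Literature.NumberTheory.Transcendental
open Literature.NumberTheory.Transcendental.BallRivoal (pfEval pf_unique poch_pos pochPoly eval_pochPoly pfEval_sub'
  pfEval_const_mul pfEval_add)
open Literature.NumberTheory.Irrationality.CressonFischlerRivoal2008 (exists_pf_data)

/-! ### CF-M3 on the face `b₇ = 0` -/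

/-- CF-M3 on the face, `Ω` removed (`Ω = 1` there), by induction on `Σ_{j≤6} b_j`: the base is the corner
`cornerIdentity`, the step is Abel's lemma `quadM3_face_step`. -/
theorem casoratianClosedForm_face_aux (n : ℕ) : ∀ b : ℕ → ℤ, InBox b → 0 ≤ dOf b →
    (∀ j ∈ Icc 1 7, b j ≤ b 0) → (∀ jk ∈ allPairs, b jk.1 + b jk.2 ≤ b 0) → b 7 = 0 →
    ∑ j ∈ range 6, (b (j + 1)).toNat = n →
    quadM3 b * (((b 0).toNat.factorial : ℚ) *
        (allPairs.map fun jk => ((b 0 - b jk.1 - b jk.2).toNat.factorial : ℚ)).prod) =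
      (-1 : ℚ) ^ (b 0).toNat * 4 * ((dOf b).toNat.factorial : ℚ) *
        (∏ j ∈ range 7, ((b 0 - b (j + 1)).toNat.factorial : ℚ)) := by
  induction n with
  | zero =>
    intro b hb hd hle hpairs h7 hsum
    -- all of `b₁,…,b₇` vanish: `b` agrees with the corner `(N;0⁷)` on `0,…,7`
    set N := (b 0).toNat with hN
    have hbN : b 0 = (N : ℤ) := (Int.toNat_of_nonneg hb.1).symm
    have hz6 : ∀ j ∈ range 6, b (j + 1) = 0 := by
      intro j hj
      have h1 : (b (j + 1)).toNat = 0 := (sum_eq_zero_iff.1 hsum) j hj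
      have h2 := (hb.2 j (by have := mem_range.1 hj; exact mem_range.2 (by omega))).1
      omega
    have hz : ∀ j, 1 ≤ j → j ≤ 7 → b j = 0 := by
      intro j hj1 hj7
      by_cases hj : j = 7
      · rw [hj]; exact h7
      · obtain ⟨k, rfl⟩ : ∃ k, j = k + 1 := ⟨j - 1, by omega⟩
        exact hz6 k (mem_range.2 (by omega))
    have hcong : ∀ j, j ≤ 7 → b j = bCorner N j := by
      intro j hj
      by_cases hj0 : j = 0
      · subst hj0; simp [bCorner, hbN]
      · rw [hz j (by omega) hj]; simp [bCorner, hj0]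
    have hM : quadM3 b = (-1) ^ N * 4 * ((3 * N).factorial : ℚ) / ((N.factorial : ℚ)) ^ 15 := by
      rw [quadM3_congr hcong, quadM3_bCorner]
    have hdN : (dOf b).toNat = 3 * N := by
      have : dOf b = ((3 * N : ℕ) : ℤ) := by
        unfold dOf
        rw [sum_eq_zero (fun j hj => hz (j + 1) (by omega) (by have := mem_range.1 hj; omega)), hbN]
        push_cast; ring
      rw [this, Int.toNat_natCast]
    have hP : (allPairs.map fun jk => ((b 0 - b jk.1 - b jk.2).toNat.factorial : ℚ)) =
        allPairs.map (fun _ => (N.factorial : ℚ)) := by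
      refine List.map_congr_left fun jk hjk => ?_
      obtain ⟨h1, h12, h2⟩ := allPairs_bounds jk hjk
      rw [hz jk.1 h1 (by omega), hz jk.2 (by omega) h2, hbN]
      simp
    have hF : ∏ j ∈ range 7, ((b 0 - b (j + 1)).toNat.factorial : ℚ) = (N.factorial : ℚ) ^ 7 := by
      refine (prod_congr rfl fun j hj => ?_).trans (by rw [prod_const, card_range])
      rw [hz (j + 1) (by omega) (by have := mem_range.1 hj; omega), hbN]
      simp
    rw [hM, hdN, hP, List.map_const', List.prod_replicate, show allPairs.length = 21 from rfl, hF]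
    have hf : (N.factorial : ℚ) ≠ 0 := by positivity
    field_simp
  | succ n ih =>
    intro b hb hd hle hpairs h7 hsum
    -- a slot `i' = i+1 ≤ 6` with `b_{i'} ≥ 1`
    obtain ⟨i, hi, hpos⟩ : ∃ i ∈ range 6, 0 < (b (i + 1)).toNat := by
      by_contra hcon
      push Not at hcon
      have : ∑ j ∈ range 6, (b (j + 1)).toNat = 0 := sum_eq_zero fun j hj => Nat.le_zero.1 (hcon j hj)
      omega
    have hi6 := mem_range.1 hi
    have hi7 : i ∈ range 7 := mem_range.2 (by omega)
    have hβ1 : 1 ≤ b (i + 1) := by have := (hb.2 i hi7).1; omega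
    have hβN : b (i + 1) ≤ b 0 := hle (i + 1) (mem_Icc.2 ⟨by omega, by omega⟩)
    -- the predecessor `a = b − e_{i'}`
    set a : ℕ → ℤ := Function.update b (i + 1) (b (i + 1) - 1) with ha
    have ha_i : a (i + 1) = b (i + 1) - 1 := Function.update_self _ _ _
    have ha_ne : ∀ k, k ≠ i + 1 → a k = b k := fun k hk => Function.update_of_ne hk _ _
    have ha0 : a 0 = b 0 := ha_ne 0 (by omega)
    have ha7 : a 7 = 0 := by rw [ha_ne 7 (by omega)]; exact h7
    have hmono : ∀ k, a k ≤ b k := by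
      intro k
      by_cases hk : k = i + 1
      · rw [hk, ha_i]; omega
      · rw [ha_ne k hk]
    have hbump : bump a i = b := by
      unfold bump
      rw [ha_i, sub_add_cancel, ha, Function.update_idem, Function.update_eq_self]
    have ha_box : InBox a := by
      refine ⟨by rw [ha0]; exact hb.1, fun j hj => ?_⟩
      by_cases hji : j = i
      · rw [hji, ha_i, ha0]
        have := (hb.2 i hi7).2
        constructor <;> omega
      · rw [ha_ne (j + 1) (by omega), ha0]; exact hb.2 j hj
    have hda : dOf a = dOf b + 1 := by
      have := dOf_bump a hi7
      rw [hbump] at this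
      omega
    have hd_a : 1 ≤ dOf a := by omega
    have hd0_a : 0 ≤ dOf a := by omega
    have hle_a : ∀ j ∈ Icc 1 7, a j ≤ a 0 := fun j hj => by rw [ha0]; exact (hmono j).trans (hle j hj)
    have hpairs_a : ∀ jk ∈ allPairs, a jk.1 + a jk.2 ≤ a 0 := fun jk hjk => by
      rw [ha0]; have := hpairs jk hjk; have := hmono jk.1; have := hmono jk.2; omega
    have hsum_a : ∑ j ∈ range 6, (a (j + 1)).toNat = n := by
      have h1 : (b (i + 1)).toNat + ∑ j ∈ (range 6).erase i, (b (j + 1)).toNat = ∑ j ∈ range 6, (b (j + 1)).toNat :=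
        add_sum_erase (range 6) (fun j => (b (j + 1)).toNat) hi
      have h2 : (a (i + 1)).toNat + ∑ j ∈ (range 6).erase i, (a (j + 1)).toNat = ∑ j ∈ range 6, (a (j + 1)).toNat :=
        add_sum_erase (range 6) (fun j => (a (j + 1)).toNat) hi
      have hrest : ∑ j ∈ (range 6).erase i, (a (j + 1)).toNat = ∑ j ∈ (range 6).erase i, (b (j + 1)).toNat :=
        sum_congr rfl fun j hj => by rw [ha_ne (j + 1) (by have := (mem_erase.1 hj).1; omega)]
      have h3 : (a (i + 1)).toNat + 1 = (b (i + 1)).toNat := by rw [ha_i]; omega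
      omega
    have hbi_a : a (i + 1) + 1 ≤ a 0 := by rw [ha_i, ha0]; omega
    -- Abel's lemma at `a` and the induction hypothesis at `a`
    have step := quadM3_face_step a ha_box ha7 hd_a hi hbi_a
    rw [hbump] at step
    have IH := ih a ha_box hd0_a hle_a hpairs_a ha7 hsum_a
    rw [ha0] at IH
    -- factorial bookkeeping
    set c : ℚ := (b 0 : ℚ) - b (i + 1) + 1 with hc
    have hc_pos : 0 < c := by
      have : ((b (i + 1) : ℤ) : ℚ) ≤ ((b 0 : ℤ) : ℚ) := by exact_mod_cast hβN
      rw [hc]; linarith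
    have hγ : faceGamma0 a i = ∏ k ∈ range 6, if k = i then (1 : ℚ) else ((b 0 : ℚ) - b (i + 1) - b (k + 1) + 1) := by
      unfold faceGamma0
      refine prod_congr rfl fun k _ => ?_
      by_cases hki : k = i
      · rw [if_pos hki, if_pos hki]
      · rw [if_neg hki, if_neg hki, ha0, ha_i, ha_ne (k + 1) (by omega)]; push_cast; ring
    have hγ_pos : 0 < faceGamma0 a i := by
      rw [hγ]
      refine prod_pos fun k hk => ?_
      by_cases hki : k = i
      · rw [if_pos hki]; exact one_pos
      · rw [if_neg hki]
        have := pair_le_of_allPairs hpairs (j := i + 1) (k := k + 1) (by omega) (by omega) (by omega)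
          (by have := mem_range.1 hk; omega) (by omega)
        have : ((b (i + 1) : ℤ) : ℚ) + ((b (k + 1) : ℤ) : ℚ) ≤ ((b 0 : ℤ) : ℚ) := by exact_mod_cast this
        linarith
    -- (F1) the pair factorials
    have F1 : (allPairs.map fun jk => ((b 0 - a jk.1 - a jk.2).toNat.factorial : ℚ)).prod =
        (allPairs.map fun jk => ((b 0 - b jk.1 - b jk.2).toNat.factorial : ℚ)).prod * (faceGamma0 a i * c) := by
      have hR : (allPairs.map fun jk : ℕ × ℕ =>
          if jk.1 = i + 1 ∨ jk.2 = i + 1 then ((b 0 : ℚ) - b jk.1 - b jk.2 + 1) else 1).prod = faceGamma0 a i * c := by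
        rw [pairRatio_prod b hi6, hγ, hc, h7]; push_cast; ring
      rw [← hR, ← List.prod_map_mul]
      congr 1
      refine List.map_congr_left fun jk hjk => ?_
      obtain ⟨h1, h12, h2⟩ := allPairs_bounds jk hjk
      by_cases hj1 : jk.1 = i + 1
      · have hk2 : jk.2 ≠ i + 1 := by omega
        rw [if_pos (Or.inl hj1), hj1, ha_i, ha_ne jk.2 hk2]
        have hnn : 0 ≤ b 0 - b (i + 1) - b jk.2 := by
          have := pair_le_of_allPairs hpairs (j := i + 1) (k := jk.2) (by omega) (by omega) (by omega) h2 (by omega)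
          omega
        rw [show b 0 - (b (i + 1) - 1) - b jk.2 = (b 0 - b (i + 1) - b jk.2) + 1 by ring, toNat_factorial_succ _ hnn]
        push_cast; ring
      · by_cases hj2 : jk.2 = i + 1
        · rw [if_pos (Or.inr hj2), hj2, ha_i, ha_ne jk.1 hj1]
          have hnn : 0 ≤ b 0 - b jk.1 - b (i + 1) := by
            have := pair_le_of_allPairs hpairs (j := jk.1) (k := i + 1) h1 (by omega) (by omega) (by omega) hj1
            omega
          rw [show b 0 - b jk.1 - (b (i + 1) - 1) = (b 0 - b jk.1 - b (i + 1)) + 1 by ring,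
            toNat_factorial_succ _ hnn]
          push_cast; ring
        · rw [if_neg (not_or.2 ⟨hj1, hj2⟩), ha_ne jk.1 hj1, ha_ne jk.2 hj2, mul_one]
    -- (F2) the single factorials
    have F2 : ∏ j ∈ range 7, ((b 0 - a (j + 1)).toNat.factorial : ℚ) =
        (∏ j ∈ range 7, ((b 0 - b (j + 1)).toNat.factorial : ℚ)) * c := by
      have : ∏ j ∈ range 7, ((b 0 - a (j + 1)).toNat.factorial : ℚ) =
          ∏ j ∈ range 7, (((b 0 - b (j + 1)).toNat.factorial : ℚ) * if j = i then c else 1) := by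
        refine prod_congr rfl fun j _ => ?_
        by_cases hji : j = i
        · rw [if_pos hji, hji, ha_i]
          have hnn : 0 ≤ b 0 - b (i + 1) := by omega
          rw [show b 0 - (b (i + 1) - 1) = (b 0 - b (i + 1)) + 1 by ring, toNat_factorial_succ _ hnn, hc]
          push_cast; ring
        · rw [if_neg hji, ha_ne (j + 1) (by omega), mul_one]
      rw [this, prod_mul_distrib, prod_ite_eq', if_pos hi7]
    -- (F3) `d(a)! = (d(b)+1)·d(b)!`
    have F3 : (((dOf a).toNat.factorial : ℕ) : ℚ) = ((dOf b : ℚ) + 1) * (((dOf b).toNat.factorial : ℕ) : ℚ) := by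
      rw [hda, toNat_factorial_succ _ hd]
    have hda' : ((dOf a : ℤ) : ℚ) = (dOf b : ℚ) + 1 := by rw [hda]; push_cast; ring
    rw [hda'] at step
    rw [F1, F2, F3] at IH
    -- cancel the nonzero factor `(d+1)·γ₀·c`
    have hd1 : (0 : ℚ) < (dOf b : ℚ) + 1 := by
      have : (0 : ℚ) ≤ (dOf b : ℚ) := by exact_mod_cast hd
      linarith
    have hne : ((dOf b : ℚ) + 1) * faceGamma0 a i * c ≠ 0 := by positivity
    refine mul_left_cancel₀ hne ?_
    set Pb := (allPairs.map fun jk => ((b 0 - b jk.1 - b jk.2).toNat.factorial : ℚ)).prod with hPb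
    set NF := ((b 0).toNat.factorial : ℚ) with hNF
    linear_combination (faceGamma0 a i * c * NF * Pb) * step + faceGamma0 a i * IH

/-- **CF-M3 ON THE FACE `b₇ = 0`** (the conjecture `casoratianClosedForm` of `WedgeDictionaryClosedForms`, restricted
to `b₇ = 0`, is a theorem): for `b` in the box with `d(b) ≥ 0`, all `b_j ≤ b₀`, all `b_j + b_k ≤ b₀ (j<k)` and
`b₇ = 0`,
`M₃(b) · b₀! · ∏_{j<k} (b₀ − b_j − b_k)! = (−1)^{b₀} · 4 · d! · ∏_j (b₀ − b_j)! · Ω(b)` (and `Ω(b) = 1`). -/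
theorem casoratianClosedForm_face (b : ℕ → ℤ) (hb : InBox b) (hd : 0 ≤ dOf b) (hle : ∀ j ∈ Icc 1 7, b j ≤ b 0)
    (hpairs : ∀ jk ∈ allPairs, b jk.1 + b jk.2 ≤ b 0) (h7 : b 7 = 0) :
    quadM3 b * (((b 0).toNat.factorial : ℚ) *
        (allPairs.map fun jk => ((b 0 - b jk.1 - b jk.2).toNat.factorial : ℚ)).prod) =
      (-1 : ℚ) ^ (b 0).toNat * 4 * ((dOf b).toNat.factorial : ℚ) *
        (∏ j ∈ range 7, ((b 0 - b (j + 1)).toNat.factorial : ℚ)) * omegaVWP b := by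
  rw [omegaVWP_eq_one (j := 6) (by simp) h7, mul_one]
  exact casoratianClosedForm_face_aux _ b hb hd hle hpairs h7 rfl

/-- **CF-M3 on EVERY face `{b_j = 0}`, `j ∈ [1,7]`** (transport of `casoratianClosedForm_face` along the slot
transposition `(j 7)`: `M₃`, `d`, the single and the pair factorials are symmetric in the slots, `Ω = 1`). -/
theorem casoratianClosedForm_of_slot_zero (b : ℕ → ℤ) (hb : InBox b) (hd : 0 ≤ dOf b)
    (hle : ∀ j ∈ Icc 1 7, b j ≤ b 0) (hpairs : ∀ jk ∈ allPairs, b jk.1 + b jk.2 ≤ b 0) {j : ℕ} (hj : j ∈ Icc 1 7)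
    (hj0 : b j = 0) :
    quadM3 b * (((b 0).toNat.factorial : ℚ) *
        (allPairs.map fun jk => ((b 0 - b jk.1 - b jk.2).toNat.factorial : ℚ)).prod) =
      (-1 : ℚ) ^ (b 0).toNat * 4 * ((dOf b).toNat.factorial : ℚ) *
        (∏ j ∈ range 7, ((b 0 - b (j + 1)).toNat.factorial : ℚ)) * omegaVWP b := by
  obtain ⟨hj1, hj7⟩ := mem_Icc.1 hj
  have h77 : (7 : ℕ) ∈ Icc 1 7 := mem_Icc.2 ⟨by norm_num, le_rfl⟩
  have e00 : Equiv.swap j 7 0 = 0 := Equiv.swap_apply_of_ne_of_ne (by omega) (by omega)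
  have hrange : ∀ i, i ∈ Icc 1 7 → Equiv.swap j 7 i ∈ Icc 1 7 := by
    intro i hi
    obtain ⟨hi1, hi7⟩ := mem_Icc.1 hi
    rw [Equiv.swap_apply_def]
    split_ifs <;> simp only [mem_Icc] <;> omega
  set b' : ℕ → ℤ := fun i => b (Equiv.swap j 7 i) with hb'def
  have eslot : ∀ i, b' i = b (Equiv.swap j 7 i) := fun i => rfl
  have e0 : b' 0 = b 0 := by rw [eslot, e00]
  have e7 : b' 7 = 0 := by rw [eslot, Equiv.swap_apply_right]; exact hj0
  have hb' : InBox b' := by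
    refine ⟨by rw [e0]; exact hb.1, fun i hi => ?_⟩
    have hi7 := mem_range.1 hi
    obtain ⟨hm1, hm7⟩ := mem_Icc.1 (hrange (i + 1) (mem_Icc.2 ⟨by omega, by omega⟩))
    have := hb.2 (Equiv.swap j 7 (i + 1) - 1) (mem_range.2 (by omega))
    rw [Nat.sub_add_cancel hm1] at this
    rw [eslot, e0]; exact this
  have hsum' : ∑ i ∈ range 7, b' (i + 1) = ∑ i ∈ range 7, b (i + 1) := by
    simp only [eslot]
    refine Finset.sum_equiv (Equiv.swap (j - 1) (7 - 1)) (fun i => ?_) (fun i _ => by rw [swap_succ hj1 (by norm_num)])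
    simp only [mem_range]
    rw [Equiv.swap_apply_def]
    split_ifs <;> omega
  have hd' : dOf b' = dOf b := by unfold dOf; rw [hsum', e0]
  have hle' : ∀ i ∈ Icc 1 7, b' i ≤ b' 0 := fun i hi => by rw [eslot, e0]; exact hle _ (hrange i hi)
  have hpairs' : ∀ jk ∈ allPairs, b' jk.1 + b' jk.2 ≤ b' 0 := by
    intro jk hjk
    obtain ⟨h1, h12, h2⟩ := allPairs_bounds jk hjk
    obtain ⟨hm1, hm1'⟩ := mem_Icc.1 (hrange jk.1 (mem_Icc.2 ⟨h1, by omega⟩))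
    obtain ⟨hm2, hm2'⟩ := mem_Icc.1 (hrange jk.2 (mem_Icc.2 ⟨by omega, h2⟩))
    have hne : Equiv.swap j 7 jk.1 ≠ Equiv.swap j 7 jk.2 := fun h => by
      have := (Equiv.swap j 7).injective h; omega
    rw [eslot, eslot, e0]
    exact pair_le_of_allPairs hpairs hm1 hm1' hm2 hm2' hne
  have key := casoratianClosedForm_face b' hb' (by rw [hd']; exact hd) hle' hpairs' e7
  -- transport every factor back to `b`
  have hq : quadM3 b' = quadM3 b := quadM3_swap b hj h77
  have hP : (allPairs.map fun jk => ((b' 0 - b' jk.1 - b' jk.2).toNat.factorial : ℚ)).prod =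
      (allPairs.map fun jk => ((b 0 - b jk.1 - b jk.2).toNat.factorial : ℚ)).prod := by
    simp only [eslot, e00]
    exact pairProd_swap7 b hj
  have hF : ∏ i ∈ range 7, ((b' 0 - b' (i + 1)).toNat.factorial : ℚ) =
      ∏ i ∈ range 7, ((b 0 - b (i + 1)).toNat.factorial : ℚ) := by
    simp only [eslot, e00]
    refine Finset.prod_equiv (Equiv.swap (j - 1) (7 - 1)) (fun i => ?_) (fun i _ => by rw [swap_succ hj1 (by norm_num)])
    simp only [mem_range]
    rw [Equiv.swap_apply_def]
    split_ifs <;> omega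
  have hΩ' : omegaVWP b' = 1 := omegaVWP_eq_one (j := 6) (by simp) e7
  have hΩ : omegaVWP b = 1 :=
    omegaVWP_eq_one (j := j - 1) (mem_range.2 (by omega)) (by rw [Nat.sub_add_cancel hj1]; exact hj0)
  rw [hq, hP, hF, hΩ', hd', e0] at key
  rw [hΩ]
  exact key

/-! ### Corollary: the fan `(n; k, 0⁶)` for every `k ≤ n` -/

/-- **The fan for ALL `k ≤ n`** (gen-1 g4's fan formula; before: `k = 0,1,2,3` by one certificate each): if `b₀ = n`,
`b₁ = k` and `b₂ = ⋯ = b₇ = 0` then `M₃(b) = (−1)ⁿ·4·(3n−k)!·(n!/(n−k)!)⁵/n!¹⁵`. -/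
theorem quadM3_fan (b : ℕ → ℤ) (n k : ℕ) (hk : k ≤ n) (h0 : b 0 = n) (h1 : b 1 = k)
    (hz : ∀ j, 2 ≤ j → j ≤ 7 → b j = 0) :
    quadM3 b = (-1) ^ n * 4 * ((3 * n - k).factorial : ℚ) * ((n.factorial : ℚ) / ((n - k).factorial : ℚ)) ^ 5 /
      (n.factorial : ℚ) ^ 15 := by
  have hs : ∑ j ∈ range 7, b (j + 1) = k := by
    rw [sum_range_succ', sum_eq_zero (fun j hj => hz (j + 1 + 1) (by omega) (by have := mem_range.1 hj; omega)),
      zero_add]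
    exact h1
  have hb : InBox b := by
    refine ⟨by rw [h0]; positivity, fun j hj => ?_⟩
    have := mem_range.1 hj
    by_cases hj0 : j = 0
    · have e : b (j + 1) = k := by subst hj0; exact h1
      rw [e, h0]; constructor <;> omega
    · rw [hz (j + 1) (by omega) (by omega), h0]; constructor <;> omega
  have hd : 0 ≤ dOf b := by unfold dOf; rw [hs, h0]; omega
  have hle : ∀ j ∈ Icc 1 7, b j ≤ b 0 := by
    intro j hj
    have := mem_Icc.1 hj
    by_cases hj1 : j = 1
    · rw [hj1, h1, h0]; omega
    · rw [hz j (by omega) (by omega), h0]; omega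
  have hpairs : ∀ jk ∈ allPairs, b jk.1 + b jk.2 ≤ b 0 := by
    intro jk hjk
    obtain ⟨hj1, h12, h2⟩ := allPairs_bounds jk hjk
    rw [hz jk.2 (by omega) h2, add_zero, h0]
    by_cases e1 : jk.1 = 1
    · rw [e1, h1]; omega
    · rw [hz jk.1 (by omega) (by omega)]; omega
  have h7 : b 7 = 0 := hz 7 (by norm_num) (by norm_num)
  have key := casoratianClosedForm_face b hb hd hle hpairs h7
  rw [omegaVWP_eq_one (j := 6) (by simp) h7, mul_one] at key
  -- evaluate the factorials at the fan point
  have hN : (b 0).toNat = n := by rw [h0]; simp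
  have hdN : (dOf b).toNat = 3 * n - k := by
    have : dOf b = ((3 * n - k : ℕ) : ℤ) := by unfold dOf; rw [hs, h0]; omega
    rw [this, Int.toNat_natCast]
  have hP : (allPairs.map fun jk => ((b 0 - b jk.1 - b jk.2).toNat.factorial : ℚ)).prod =
      ((n - k).factorial : ℚ) ^ 6 * (n.factorial : ℚ) ^ 15 := by
    have : (allPairs.map fun jk => ((b 0 - b jk.1 - b jk.2).toNat.factorial : ℚ)) =
        allPairs.map (fun jk : ℕ × ℕ => if jk.1 = 1 then ((n - k).factorial : ℚ) else (n.factorial : ℚ)) := by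
      refine List.map_congr_left fun jk hjk => ?_
      obtain ⟨hj1, h12, h2⟩ := allPairs_bounds jk hjk
      rw [hz jk.2 (by omega) h2, sub_zero, h0]
      by_cases e1 : jk.1 = 1
      · rw [if_pos e1, e1, h1, show ((n : ℤ) - (k : ℤ)).toNat = n - k by omega]
      · rw [if_neg e1, hz jk.1 (by omega) (by omega), sub_zero, Int.toNat_natCast]
    rw [this]
    simp [allPairs]
    ring
  have h6 : ∏ j ∈ range 6, ((b 0 - b (j + 1 + 1)).toNat.factorial : ℚ) = (n.factorial : ℚ) ^ 6 := by
    refine (prod_congr rfl fun j hj => ?_).trans (by rw [prod_const, card_range])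
    rw [hz (j + 1 + 1) (by omega) (by have := mem_range.1 hj; omega), sub_zero, h0, Int.toNat_natCast]
  have hF : ∏ j ∈ range 7, ((b 0 - b (j + 1)).toNat.factorial : ℚ) =
      ((n - k).factorial : ℚ) * (n.factorial : ℚ) ^ 6 := by
    rw [prod_range_succ', h6, show b (0 + 1) = (k : ℤ) from h1, h0, show ((n : ℤ) - (k : ℤ)).toNat = n - k by omega]
    ring
  rw [hN, hdN, hP, hF] at key
  have hf : (n.factorial : ℚ) ≠ 0 := by positivity
  have hfk : ((n - k).factorial : ℚ) ≠ 0 := by positivity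
  have hM : quadM3 b = (-1 : ℚ) ^ n * 4 * ((3 * n - k).factorial : ℚ) * (((n - k).factorial : ℚ) * (n.factorial : ℚ) ^ 6) /
      ((n.factorial : ℚ) * (((n - k).factorial : ℚ) ^ 6 * (n.factorial : ℚ) ^ 15)) := by
    rw [eq_div_iff (by positivity)]
    exact key
  rw [hM]
  field_simp

end Summit.KontsevichZagierPeriods.Zeta5Search.WedgeDictionary
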